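import Mathlib
import Summits.NavierStokesRegularity.NavierStokesRegularity.Theorems.ThreadingFluxHorizonTowerThirdDigit
import HarnessLib

/-!
# Crux `PoloidalLiouville` (stmt-NavierStokesRegularity-1222), crux idea «horizon-threading-tower» (ns-idea-15):
# THE FOURTH CONE DIGIT, I — monomial calculus `L^a M^j` in every degree and the third-order harmonic remainders

Support file (`--supports stmt-NavierStokesRegularity-1222`, helper; cell `ns-wall-extremal`, width hand ns-wall-eng-3 g7; 0 kit), toward
THM K «a finite tower whose top pair `(D′, D) = (2(m+2), 2(n+2))` has `m + 2 ⊥ n + 2` (gcd 2), WITH the competitor shell `D′ − 2` AND the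
shell `D′ − 4` free, is coaxially zonal at order one» (`FiniteTowerGcdTwoTwoShellsHorizonTowerZonality`, Defs append XI).  The fourth
`ρ`-adic digit of the class identity needs every shell to one order more than THM J (`…ThirdDigit`): this file supplies the Leibniz closed
forms, all stated for EVERY exponent and multiplied by the power of `L` that makes natural-number subtraction unnecessary
(`L = xᵀQx`, `M = |Qx|²`, `W = det(x,Qx,Q²x)`, `ρ = |x|²`, `τ = tr Q²`, `δ = det Q`; `{·,·} = detP`, `∇·∇ = dotP`, `Δ = lapP`):
* powers: `dotP X (Y^{k+1}) = (k+1) Y^k dotP X Y`; `L·∇M·∇(L^m) = 2mτ L^{m+1} + 4mδ ρL^m`;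
  `L·∇L·∇(L^m M) = 4m L^m M² + 2τ L^{m+2} + 4δ ρL^{m+1}`, `L·∇L·∇(L^m M²) = 4m L^m M³ + 4τ L^{m+2}M + 8δ ρL^{m+1}M`,
  `L·∇M·∇(L^m M) = 2(m+1)τ L^{m+1}M + 4δ L^{m+2} + 4mδ ρL^m M`, `L·∇M·∇(L^m M²) = 2(m+2)τ L^{m+1}M² + 8δ L^{m+2}M + 4mδ ρL^m M²`;
* Laplacians: `L²Δ(L^m) = 4m(m−1) L^m M`; ★ `L²Δ(L^m M²) = 4m(m−1) L^m M³ + (8m+8)τ L^{m+2}M + 8δ L^{m+3} + 16mδ ρL^{m+1}M`;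
  `L²Δ(L^m M³) = 4m(m−1) L^m M⁴ + (12m+18)τ L^{m+2}M² + 24δ L^{m+3}M + 24mδ ρL^{m+1}M²`; `L·Δ(L^{m+1}M)` and `Δ(L^{m+2}M)` unmultiplied;
  ★★ `L⁴Δ²(L^m M) = 16m(m−1)(m−2)(m−3) L^m M³ + 24m(m−1)(2m−1)τ L^{m+2}M + 48m(2m−1)δ L^{m+3} + 96m(m−1)(m−2)δ ρL^{m+1}M`,
  ★ `L³Δ²(L^{m+1}) = 16(m+1)m(m−1)(m−2) L^m M² + 8(m+1)m(2m−1)τ L^{m+2} + 32(m+1)m(m−1)δ ρL^{m+1}`;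
* brackets of monomials: `{L, L^bM^{k+1}} = 4(k+1) L^bM^kW`, `L{L^a, L^bM^{k+1}} = 4a(k+1) L^{a+b}M^kW`,
  `L{L^aM^{j+1}, L^b} = −4b(j+1) L^{a+b}M^jW`, ★ `L{L^aM^{j+1}, L^bM^{k+1}} = 4(a(k+1) − b(j+1)) L^{a+b}M^{j+k+1}W`;
* ★ THIRD-ORDER REMAINDERS: for a shell `γL^{k+3} + ρG` (`(8k+22)G = A·L^{k+1}M − ρΔG`): `(24k+42)Δ²G = A·Δ²(L^{k+1}M) − ρΔ³G`; for the
  confined competitor `κ₀L^{k+3} + κ₁L^{k+2}M + ρG_c` (harmonic): `(8k+22)G_c = −κ₀Δ(L^{k+3}) − κ₁Δ(L^{k+2}M) − ρΔG_c` and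
  `(16k+36)ΔG_c = −κ₀Δ²(L^{k+3}) − κ₁Δ²(L^{k+2}M) − ρΔ²G_c`; for the confined `D′−4` shell `a₀L^kM² + b₀L^{k+1}M + γL^{k+2} + ρG_b`
  (harmonic): `(8k+14)G_b = −(a₀Δ(L^kM²) + b₀Δ(L^{k+1}M) + γΔ(L^{k+2})) − ρΔG_b`.

HONEST LABEL: polynomial algebra about one crux idea's typed objects; no Prop of the sketch is closed here; `HorizonTowerZonality`
(general towers), `PoloidalLiouville` (1222) OPEN; NS regularity NOT proved.  [folklore]
-/

-- the summit and its single sub-problem share the name (CONVENTIONS §1)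
set_option linter.dupNamespace false
-- `simp only` closers over `C`-coefficients are import-order sensitive (simprocs); keep the lists explicit, silence the arg linter
set_option linter.unusedSimpArgs false

noncomputable section

open MvPolynomial

namespace Summit.NavierStokesRegularity.NavierStokesRegularity.Theorems.PoloidalLiouville.HorizonTower.Zonal

section Real

variable (a b d e f : ℝ)

/-! ### Powers and first derivatives -/

/-- `∇X·∇(Y^{k+1}) = (k+1) Y^k ∇X·∇Y`. [folklore] -/
theorem dotP_pow_succ_right (P Y : RPoly) (k : ℕ) : dotP P (Y ^ (k + 1)) = C ((k : ℝ) + 1) * Y ^ k * dotP P Y := by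
  induction k with
  | zero => simp only [zero_add, pow_one, pow_zero, Nat.cast_zero, map_one, one_mul]
  | succ k ih =>
    rw [pow_succ, dotP_mul_right, ih]
    simp only [map_add, map_natCast, map_one, Nat.cast_succ]
    ring

/-- `L · ∇M·∇(L^m) = 2mτ · L^{m+1} + 4mδ · ρL^m`. [folklore] -/
theorem genL_mul_dotP_genM_genL_pow (m : ℕ) :
    genL a b d e f * dotP (genM a b d e f) (genL a b d e f ^ m)
      = C (2 * (m : ℝ) * genTau a b d e f) * genL a b d e f ^ (m + 1) + C (4 * (m : ℝ) * genDelta a b d e f) * normSq * genL a b d e f ^ m := by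
  cases m with
  | zero => rw [pow_zero, ← C_1, dotP_C_right]; simp
  | succ k =>
    rw [dotP_pow_succ_right, dotP_genM_genL]
    simp only [map_mul, map_add, map_natCast, map_one, map_ofNat, Nat.cast_succ]
    ring

/-- `L · ∇L·∇(L^m M) = 4m · L^m M² + 2τ · L^{m+2} + 4δ · ρL^{m+1}`. [folklore] -/
theorem genL_mul_dotP_genL_genL_pow_mul_genM (m : ℕ) :
    genL a b d e f * dotP (genL a b d e f) (genL a b d e f ^ m * genM a b d e f)
      = C (4 * (m : ℝ)) * genL a b d e f ^ m * genM a b d e f ^ 2 + C (2 * genTau a b d e f) * genL a b d e f ^ (m + 2)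
        + C (4 * genDelta a b d e f) * normSq * genL a b d e f ^ (m + 1) := by
  have h := genL_mul_dotP_genL_pow a b d e f m
  rw [dotP_mul_right, mul_add, show genL a b d e f * (genL a b d e f ^ m * dotP (genL a b d e f) (genM a b d e f))
      = genL a b d e f ^ (m + 1) * dotP (genL a b d e f) (genM a b d e f) by ring, dotP_genL_genM,
    show genL a b d e f * (genM a b d e f * dotP (genL a b d e f) (genL a b d e f ^ m))
      = genM a b d e f * (genL a b d e f * dotP (genL a b d e f) (genL a b d e f ^ m)) by ring, h]
  simp only [map_mul, map_add, map_natCast, map_ofNat]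
  ring

/-- `L · ∇L·∇(L^m M²) = 4m · L^m M³ + 4τ · L^{m+2}M + 8δ · ρL^{m+1}M`. [folklore] -/
theorem genL_mul_dotP_genL_genL_pow_mul_genM_sq (m : ℕ) :
    genL a b d e f * dotP (genL a b d e f) (genL a b d e f ^ m * genM a b d e f ^ 2)
      = C (4 * (m : ℝ)) * genL a b d e f ^ m * genM a b d e f ^ 3 + C (4 * genTau a b d e f) * genL a b d e f ^ (m + 2) * genM a b d e f
        + C (8 * genDelta a b d e f) * normSq * genL a b d e f ^ (m + 1) * genM a b d e f := by
  have h := genL_mul_dotP_genL_genL_pow_mul_genM a b d e f m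
  rw [show genL a b d e f ^ m * genM a b d e f ^ 2 = (genL a b d e f ^ m * genM a b d e f) * genM a b d e f by ring, dotP_mul_right,
    mul_add, show genL a b d e f * ((genL a b d e f ^ m * genM a b d e f) * dotP (genL a b d e f) (genM a b d e f))
      = genL a b d e f ^ (m + 1) * genM a b d e f * dotP (genL a b d e f) (genM a b d e f) by ring, dotP_genL_genM,
    show genL a b d e f * (genM a b d e f * dotP (genL a b d e f) (genL a b d e f ^ m * genM a b d e f))
      = genM a b d e f * (genL a b d e f * dotP (genL a b d e f) (genL a b d e f ^ m * genM a b d e f)) by ring, h]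
  simp only [map_mul, map_add, map_natCast, map_ofNat]
  ring

/-- `L · ∇M·∇(L^m M) = 2(m+1)τ · L^{m+1}M + 4δ · L^{m+2} + 4mδ · ρL^m M`. [folklore] -/
theorem genL_mul_dotP_genM_genL_pow_mul_genM (m : ℕ) :
    genL a b d e f * dotP (genM a b d e f) (genL a b d e f ^ m * genM a b d e f)
      = C (2 * ((m : ℝ) + 1) * genTau a b d e f) * genL a b d e f ^ (m + 1) * genM a b d e f
        + C (4 * genDelta a b d e f) * genL a b d e f ^ (m + 2) + C (4 * (m : ℝ) * genDelta a b d e f) * normSq * genL a b d e f ^ m * genM a b d e f := by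
  have h := genL_mul_dotP_genM_genL_pow a b d e f m
  rw [dotP_mul_right, mul_add, show genL a b d e f * (genL a b d e f ^ m * dotP (genM a b d e f) (genM a b d e f))
      = genL a b d e f ^ (m + 1) * dotP (genM a b d e f) (genM a b d e f) by ring, dotP_genM_genM,
    show genL a b d e f * (genM a b d e f * dotP (genM a b d e f) (genL a b d e f ^ m))
      = genM a b d e f * (genL a b d e f * dotP (genM a b d e f) (genL a b d e f ^ m)) by ring, h]
  simp only [map_mul, map_add, map_natCast, map_ofNat, map_one]
  ring

/-- `L · ∇M·∇(L^m M²) = 2(m+2)τ · L^{m+1}M² + 8δ · L^{m+2}M + 4mδ · ρL^m M²`. [folklore] -/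
theorem genL_mul_dotP_genM_genL_pow_mul_genM_sq (m : ℕ) :
    genL a b d e f * dotP (genM a b d e f) (genL a b d e f ^ m * genM a b d e f ^ 2)
      = C (2 * ((m : ℝ) + 2) * genTau a b d e f) * genL a b d e f ^ (m + 1) * genM a b d e f ^ 2
        + C (8 * genDelta a b d e f) * genL a b d e f ^ (m + 2) * genM a b d e f
        + C (4 * (m : ℝ) * genDelta a b d e f) * normSq * genL a b d e f ^ m * genM a b d e f ^ 2 := by
  have h := genL_mul_dotP_genM_genL_pow_mul_genM a b d e f m
  rw [show genL a b d e f ^ m * genM a b d e f ^ 2 = (genL a b d e f ^ m * genM a b d e f) * genM a b d e f by ring, dotP_mul_right,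
    mul_add, show genL a b d e f * ((genL a b d e f ^ m * genM a b d e f) * dotP (genM a b d e f) (genM a b d e f))
      = genL a b d e f ^ (m + 1) * genM a b d e f * dotP (genM a b d e f) (genM a b d e f) by ring, dotP_genM_genM,
    show genL a b d e f * (genM a b d e f * dotP (genM a b d e f) (genL a b d e f ^ m * genM a b d e f))
      = genM a b d e f * (genL a b d e f * dotP (genM a b d e f) (genL a b d e f ^ m * genM a b d e f)) by ring, h]
  simp only [map_mul, map_add, map_natCast, map_ofNat, map_one]
  ring

/-! ### Laplacians of `L^m M^j` -/

/-- `L² · Δ(L^m) = 4m(m−1) · L^m M` for every `m`. [folklore] -/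
theorem genL_sq_mul_lapP_genL_pow (m : ℕ) :
    genL a b d e f ^ 2 * lapP (genL a b d e f ^ m) = C (4 * (m : ℝ) * ((m : ℝ) - 1)) * genL a b d e f ^ m * genM a b d e f := by
  rcases m with _ | _ | k
  · rw [pow_zero, ← C_1, lapP_C']; simp
  · rw [zero_add, pow_one, lapP_genL]; simp
  · rw [show k + 1 + 1 = k + 2 by ring, lapP_genL_pow]
    simp only [map_mul, map_add, map_sub, map_natCast, map_ofNat, map_one, Nat.cast_add, Nat.cast_ofNat]
    ring

/-- `L · Δ(L^{m+1} M) = (4m+6)τ · L^{m+2} + 4(m+1)m · L^m M² + 8(m+1)δ · ρL^{m+1}` (one `L` suffices one degree up). [folklore] -/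
theorem genL_mul_lapP_genL_pow_succ_mul_genM (m : ℕ) :
    genL a b d e f * lapP (genL a b d e f ^ (m + 1) * genM a b d e f)
      = C ((4 * (m : ℝ) + 6) * genTau a b d e f) * genL a b d e f ^ (m + 2)
        + C (4 * ((m : ℝ) + 1) * m) * genL a b d e f ^ m * genM a b d e f ^ 2
        + C (8 * ((m : ℝ) + 1) * genDelta a b d e f) * normSq * genL a b d e f ^ (m + 1) := by
  have h1 := genL_sq_mul_lapP_genL_pow_mul_genM a b d e f m
  have h2 := genL_mul_dotP_genL_genL_pow_mul_genM a b d e f m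
  have hexp : lapP (genL a b d e f ^ (m + 1) * genM a b d e f)
      = genL a b d e f * lapP (genL a b d e f ^ m * genM a b d e f)
        + C 2 * dotP (genL a b d e f) (genL a b d e f ^ m * genM a b d e f) := by
    rw [show genL a b d e f ^ (m + 1) * genM a b d e f = genL a b d e f * (genL a b d e f ^ m * genM a b d e f) by ring, lapP_mul,
      lapP_genL]
    ring
  rw [hexp]
  simp only [map_mul, map_add, map_sub, map_natCast, map_ofNat, map_one] at h1 h2 ⊢
  linear_combination h1 + 2 * h2

/-- ★ `L² · Δ(L^m M²) = 4m(m−1) · L^m M³ + (8m+8)τ · L^{m+2}M + 8δ · L^{m+3} + 16mδ · ρL^{m+1}M`. [folklore] -/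
theorem genL_sq_mul_lapP_genL_pow_mul_genM_sq (m : ℕ) :
    genL a b d e f ^ 2 * lapP (genL a b d e f ^ m * genM a b d e f ^ 2)
      = C (4 * (m : ℝ) * ((m : ℝ) - 1)) * genL a b d e f ^ m * genM a b d e f ^ 3
        + C ((8 * (m : ℝ) + 8) * genTau a b d e f) * genL a b d e f ^ (m + 2) * genM a b d e f
        + C (8 * genDelta a b d e f) * genL a b d e f ^ (m + 3)
        + C (16 * (m : ℝ) * genDelta a b d e f) * normSq * genL a b d e f ^ (m + 1) * genM a b d e f := by
  have h1 := genL_sq_mul_lapP_genL_pow_mul_genM a b d e f m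
  have h2 := genL_mul_dotP_genM_genL_pow_mul_genM a b d e f m
  have hexp : lapP (genL a b d e f ^ m * genM a b d e f ^ 2)
      = genL a b d e f ^ m * genM a b d e f * lapP (genM a b d e f) + genM a b d e f * lapP (genL a b d e f ^ m * genM a b d e f)
        + C 2 * dotP (genM a b d e f) (genL a b d e f ^ m * genM a b d e f) := by
    rw [show genL a b d e f ^ m * genM a b d e f ^ 2 = (genL a b d e f ^ m * genM a b d e f) * genM a b d e f by ring, lapP_mul,
      dotP_comm]
  rw [hexp, lapP_genM]
  simp only [map_mul, map_add, map_sub, map_natCast, map_ofNat, map_one] at h1 h2 ⊢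
  linear_combination genM a b d e f * h1 + 2 * genL a b d e f * h2

/-- `L² · Δ(L^m M³) = 4m(m−1) · L^m M⁴ + (12m+18)τ · L^{m+2}M² + 24δ · L^{m+3}M + 24mδ · ρL^{m+1}M²`. [folklore] -/
theorem genL_sq_mul_lapP_genL_pow_mul_genM_cube (m : ℕ) :
    genL a b d e f ^ 2 * lapP (genL a b d e f ^ m * genM a b d e f ^ 3)
      = C (4 * (m : ℝ) * ((m : ℝ) - 1)) * genL a b d e f ^ m * genM a b d e f ^ 4
        + C ((12 * (m : ℝ) + 18) * genTau a b d e f) * genL a b d e f ^ (m + 2) * genM a b d e f ^ 2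
        + C (24 * genDelta a b d e f) * genL a b d e f ^ (m + 3) * genM a b d e f
        + C (24 * (m : ℝ) * genDelta a b d e f) * normSq * genL a b d e f ^ (m + 1) * genM a b d e f ^ 2 := by
  have h1 := genL_sq_mul_lapP_genL_pow_mul_genM_sq a b d e f m
  have h2 := genL_mul_dotP_genM_genL_pow_mul_genM_sq a b d e f m
  have hexp : lapP (genL a b d e f ^ m * genM a b d e f ^ 3)
      = genL a b d e f ^ m * genM a b d e f ^ 2 * lapP (genM a b d e f) + genM a b d e f * lapP (genL a b d e f ^ m * genM a b d e f ^ 2)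
        + C 2 * dotP (genM a b d e f) (genL a b d e f ^ m * genM a b d e f ^ 2) := by
    rw [show genL a b d e f ^ m * genM a b d e f ^ 3 = (genL a b d e f ^ m * genM a b d e f ^ 2) * genM a b d e f by ring, lapP_mul,
      dotP_comm]
  rw [hexp, lapP_genM]
  simp only [map_mul, map_add, map_sub, map_natCast, map_ofNat, map_one] at h1 h2 ⊢
  linear_combination genM a b d e f * h1 + 2 * genL a b d e f * h2

/-- ★★ **`Δ²` of `L^m M`**: `L⁴ · Δ(Δ(L^m M)) = 16m(m−1)(m−2)(m−3) · L^m M³ + 24m(m−1)(2m−1)τ · L^{m+2}M + 48m(2m−1)δ · L^{m+3}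
+ 96m(m−1)(m−2)δ · ρL^{m+1}M` for every `m`. [folklore] -/
theorem genL_pow_four_mul_lapP_lapP_genL_pow_mul_genM (m : ℕ) :
    genL a b d e f ^ 4 * lapP (lapP (genL a b d e f ^ m * genM a b d e f))
      = C (16 * (m : ℝ) * ((m : ℝ) - 1) * ((m : ℝ) - 2) * ((m : ℝ) - 3)) * genL a b d e f ^ m * genM a b d e f ^ 3
        + C (24 * (m : ℝ) * ((m : ℝ) - 1) * (2 * (m : ℝ) - 1) * genTau a b d e f) * genL a b d e f ^ (m + 2) * genM a b d e f
        + C (48 * (m : ℝ) * (2 * (m : ℝ) - 1) * genDelta a b d e f) * genL a b d e f ^ (m + 3)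
        + C (96 * (m : ℝ) * ((m : ℝ) - 1) * ((m : ℝ) - 2) * genDelta a b d e f) * normSq * genL a b d e f ^ (m + 1) * genM a b d e f := by
  set Y : RPoly := lapP (genL a b d e f ^ m * genM a b d e f) with hY
  -- `L² Y = R₁` (THM J's closed form), reassociated
  have h0 := genL_sq_mul_lapP_genL_pow_mul_genM a b d e f m
  rw [← hY] at h0
  have h0' : genL a b d e f ^ 2 * Y = C ((4 * (m : ℝ) + 2) * genTau a b d e f) * genL a b d e f ^ (m + 2)
      + C (4 * (m : ℝ) * ((m : ℝ) - 1)) * (genL a b d e f ^ m * genM a b d e f ^ 2)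
      + C (8 * (m : ℝ) * genDelta a b d e f) * (normSq * genL a b d e f ^ (m + 1)) := by
    rw [h0]; ring
  have hL2 : lapP (genL a b d e f ^ 2) = C 8 * genM a b d e f := by
    have h := lapP_genL_pow a b d e f 0
    rw [zero_add, pow_zero, mul_one] at h
    rw [h]; norm_num
  have hdL2 : dotP (genL a b d e f) (genL a b d e f ^ 2) = C 8 * genL a b d e f * genM a b d e f := by
    rw [pow_two, dotP_mul_right, dotP_genL_genL]; simp only [map_ofNat]; ring
  -- (ii) `Δ(L² Y) = L² ΔY + 8M Y + 4L ∇L·∇Y`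
  have hii : lapP (genL a b d e f ^ 2 * Y) = genL a b d e f ^ 2 * lapP Y + C 8 * genM a b d e f * Y
      + C 4 * genL a b d e f * dotP (genL a b d e f) Y := by
    rw [lapP_mul, hL2, pow_two, dotP_mul_left]; simp only [map_ofNat]; ring
  -- (iii) `∇L·∇(L² Y) = L² ∇L·∇Y + 8LM Y`
  have hiii : dotP (genL a b d e f) (genL a b d e f ^ 2 * Y) = genL a b d e f ^ 2 * dotP (genL a b d e f) Y
      + C 8 * genL a b d e f * genM a b d e f * Y := by
    rw [dotP_mul_right, hdL2]; ring
  -- the explicit pieces of `Δ R₁` and `∇L·∇R₁`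
  have hA := lapP_genL_pow a b d e f m                           -- Δ(L^{m+2})
  have hB := genL_sq_mul_lapP_genL_pow_mul_genM_sq a b d e f m   -- L²Δ(L^m M²)
  have hC := genL_sq_mul_lapP_genL_pow a b d e f (m + 1)         -- L²Δ(L^{m+1})
  have hD := genL_mul_dotP_genL_pow a b d e f (m + 2)            -- L ∇L·∇(L^{m+2})
  have hE := genL_mul_dotP_genL_genL_pow_mul_genM_sq a b d e f m -- L ∇L·∇(L^m M²)
  have hF := genL_mul_dotP_genL_pow a b d e f (m + 1)            -- L ∇L·∇(L^{m+1})
  have hhomL : (genL a b d e f ^ (m + 1)).IsHomogeneous (2 * m + 2) := by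
    have h := (isHomogeneous_genL a b d e f).pow (m + 1)
    rwa [show 2 * (m + 1) = 2 * m + 2 by ring] at h
  have hG : lapP (normSq * genL a b d e f ^ (m + 1)) = C (4 * ((2 * m + 2 : ℕ) : ℝ) + 6) * genL a b d e f ^ (m + 1)
      + normSq * lapP (genL a b d e f ^ (m + 1)) := lapP_normSq_mul_of_isHomogeneous hhomL
  have hH : dotP (genL a b d e f) (normSq * genL a b d e f ^ (m + 1)) = genL a b d e f ^ (m + 1) * (C 4 * genL a b d e f)
      + normSq * dotP (genL a b d e f) (genL a b d e f ^ (m + 1)) := by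
    rw [dotP_mul_right, dotP_genL_normSq]; ring
  rw [h0', lapP_add, lapP_add, lapP_C_mul, lapP_C_mul, lapP_C_mul, hA, hG] at hii
  rw [h0', dotP_add_right, dotP_add_right, dotP_C_mul_right, dotP_C_mul_right, dotP_C_mul_right, hH] at hiii
  simp only [map_mul, map_add, map_sub, map_natCast, map_ofNat, map_one, Nat.cast_add, Nat.cast_mul, Nat.cast_ofNat] at hii hiii h0
  simp only [map_mul, map_add, map_sub, map_natCast, map_ofNat, map_one, Nat.cast_add, Nat.cast_mul, Nat.cast_ofNat] at hB hC hD hE hF ⊢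
  -- `L⁴ ΔY = L² ΔR₁ − 4 L ∇L·∇R₁ + 24 M R₁`
  linear_combination (-(genL a b d e f ^ 2)) * hii + (4 * genL a b d e f) * hiii + (24 * genM a b d e f) * h0
    + (4 * (m : RPoly) * ((m : RPoly) - 1)) * hB
    + (8 * (m : RPoly) * C (genDelta a b d e f) * normSq) * hC
    - (4 * ((4 * (m : RPoly) + 2) * C (genTau a b d e f))) * hD
    - (4 * (4 * (m : RPoly) * ((m : RPoly) - 1))) * hE
    - (4 * (8 * (m : RPoly) * C (genDelta a b d e f)) * normSq) * hF

/-- ★ **`Δ²` of `L^{m+1}`**: `L³ · Δ(Δ(L^{m+1})) = 16(m+1)m(m−1)(m−2) · L^m M² + 8(m+1)m(2m−1)τ · L^{m+2} + 32(m+1)m(m−1)δ · ρL^{m+1}`.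
[folklore] -/
theorem genL_cube_mul_lapP_lapP_genL_pow_succ (m : ℕ) :
    genL a b d e f ^ 3 * lapP (lapP (genL a b d e f ^ (m + 1)))
      = C (16 * ((m : ℝ) + 1) * m * ((m : ℝ) - 1) * ((m : ℝ) - 2)) * genL a b d e f ^ m * genM a b d e f ^ 2
        + C (8 * ((m : ℝ) + 1) * m * (2 * (m : ℝ) - 1) * genTau a b d e f) * genL a b d e f ^ (m + 2)
        + C (32 * ((m : ℝ) + 1) * m * ((m : ℝ) - 1) * genDelta a b d e f) * normSq * genL a b d e f ^ (m + 1) := by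
  set Y : RPoly := lapP (genL a b d e f ^ (m + 1)) with hY
  have h0 := genL_mul_lapP_genL_pow_succ a b d e f m
  rw [← hY] at h0
  have h0' : genL a b d e f * Y = C (4 * ((m : ℝ) + 1) * m) * (genL a b d e f ^ m * genM a b d e f) := by rw [h0]; ring
  have hii : lapP (genL a b d e f * Y) = genL a b d e f * lapP Y + C 2 * dotP (genL a b d e f) Y := by
    rw [lapP_mul, lapP_genL]; ring
  have hiii : dotP (genL a b d e f) (genL a b d e f * Y) = genL a b d e f * dotP (genL a b d e f) Y
      + C 4 * genM a b d e f * Y := by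
    rw [dotP_mul_right, dotP_genL_genL]; ring
  have h1 := genL_sq_mul_lapP_genL_pow_mul_genM a b d e f m
  have hD := genL_mul_dotP_genL_genL_pow_mul_genM a b d e f m
  rw [h0', lapP_C_mul] at hii
  rw [h0', dotP_C_mul_right] at hiii
  simp only [map_mul, map_add, map_sub, map_natCast, map_ofNat, map_one] at hii hiii h0 h1 hD ⊢
  linear_combination (-(genL a b d e f ^ 2)) * hii + (2 * genL a b d e f) * hiii + (8 * genM a b d e f) * h0
    + (4 * ((m : RPoly) + 1) * (m : RPoly)) * h1 - (2 * (4 * ((m : RPoly) + 1) * (m : RPoly))) * hD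

/-! ### Brackets of monomials `L^a M^j` -/

/-- `L · {X, L^n} = n · L^n {X, L}`. [folklore] -/
theorem genL_mul_detP_genL_pow_right (P : RPoly) (n : ℕ) :
    genL a b d e f * detP P (genL a b d e f ^ n) = C (n : ℝ) * genL a b d e f ^ n * detP P (genL a b d e f) := by
  cases n with
  | zero => rw [pow_zero, ← C_1, detP_C_right]; simp
  | succ j =>
    rw [detP_pow_right]
    simp only [map_add, map_natCast, map_one, Nat.cast_succ]
    ring

/-- `{M^{j+1}, M^{k+1}} = 0`. [folklore] -/
theorem detP_genM_pow_succ_genM_pow_succ (j k : ℕ) :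
    detP (genM a b d e f ^ (j + 1)) (genM a b d e f ^ (k + 1)) = 0 := by
  rw [detP_pow_left, detP_pow_right, detP_self, mul_zero, mul_zero]

/-- `{L, L^n M^{k+1}} = 4(k+1) · L^n M^k W`. [folklore] -/
theorem detP_genL_genL_pow_mul_genM_pow (n k : ℕ) :
    detP (genL a b d e f) (genL a b d e f ^ n * genM a b d e f ^ (k + 1))
      = C (4 * ((k : ℝ) + 1)) * genL a b d e f ^ n * genM a b d e f ^ k * genW a b d e f := by
  rw [detP_mul_right, detP_pow_right, detP_genL_genM, detP_pow_self, mul_zero, add_zero]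
  simp only [map_mul, map_add, map_natCast, map_ofNat, map_one]
  ring

/-- `L · {L^m, L^n M^{k+1}} = 4m(k+1) · L^{m+n} M^k W`. [folklore] -/
theorem genL_mul_detP_genL_pow_genL_pow_mul_genM_pow (m n k : ℕ) :
    genL a b d e f * detP (genL a b d e f ^ m) (genL a b d e f ^ n * genM a b d e f ^ (k + 1))
      = C (4 * (m : ℝ) * ((k : ℝ) + 1)) * genL a b d e f ^ (m + n) * genM a b d e f ^ k * genW a b d e f := by
  cases m with
  | zero => rw [pow_zero, ← C_1, detP_C_left]; simp
  | succ j =>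
    rw [detP_pow_left, detP_genL_genL_pow_mul_genM_pow]
    simp only [map_mul, map_add, map_natCast, map_ofNat, map_one, Nat.cast_succ]
    ring

/-- `L · {L^m M^{j+1}, L^n} = −4n(j+1) · L^{m+n} M^j W`. [folklore] -/
theorem genL_mul_detP_genL_pow_mul_genM_pow_genL_pow (m j n : ℕ) :
    genL a b d e f * detP (genL a b d e f ^ m * genM a b d e f ^ (j + 1)) (genL a b d e f ^ n)
      = -(C (4 * (n : ℝ) * ((j : ℝ) + 1)) * genL a b d e f ^ (m + n) * genM a b d e f ^ j * genW a b d e f) := by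
  have h := genL_mul_detP_genL_pow_genL_pow_mul_genM_pow a b d e f n m j
  rw [detP_antisymm, mul_neg, h, add_comm n m]

/-- ★ `L · {L^m M^{j+1}, L^n M^{k+1}} = 4(m(k+1) − n(j+1)) · L^{m+n} M^{j+k+1} W`. [folklore] -/
theorem genL_mul_detP_genL_pow_mul_genM_pow (m j n k : ℕ) :
    genL a b d e f * detP (genL a b d e f ^ m * genM a b d e f ^ (j + 1)) (genL a b d e f ^ n * genM a b d e f ^ (k + 1))
      = C (4 * ((m : ℝ) * ((k : ℝ) + 1) - (n : ℝ) * ((j : ℝ) + 1))) * genL a b d e f ^ (m + n) * genM a b d e f ^ (j + k + 1)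
        * genW a b d e f := by
  have h1 := genL_mul_detP_genL_pow_genL_pow_mul_genM_pow a b d e f m n k
  have h3 := genL_mul_detP_genL_pow_right a b d e f (genM a b d e f) n
  rw [detP_genM_genL] at h3
  rw [detP_mul_left, detP_mul_right, detP_genM_pow_succ_genM_pow_succ, mul_zero, zero_add, detP_pow_left _ _ j]
  simp only [map_mul, map_add, map_sub, map_natCast, map_ofNat, map_one] at h1 h3 ⊢
  linear_combination genL a b d e f ^ m * genM a b d e f ^ (k + 1) * (((j : RPoly) + 1) * genM a b d e f ^ j) * h3
    + genM a b d e f ^ (j + 1) * h1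

/-! ### Third-order harmonic remainders -/

/-- ★ **THIRD-ORDER REMAINDER.**  If `(8k+22)G = A·L^{k+1} M − ρΔG` with `G` homogeneous of degree `2k + 4` (the harmonic remainder of a
shell `γL^{k+3} + ρG`, `…SecondDigit`), then `(24k+42)Δ²G = A·Δ²(L^{k+1} M) − ρ·Δ³G`. [folklore] -/
theorem lapP_lapP_remainder {G : RPoly} {A : ℝ} {k : ℕ} (hG : G.IsHomogeneous (2 * k + 4))
    (h : C (8 * (k : ℝ) + 22) * G = C A * genL a b d e f ^ (k + 1) * genM a b d e f - normSq * lapP G) :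
    C (24 * (k : ℝ) + 42) * lapP (lapP G)
      = C A * lapP (lapP (genL a b d e f ^ (k + 1) * genM a b d e f)) - normSq * lapP (lapP (lapP G)) := by
  have hG' : G.IsHomogeneous (2 * (k + 1) + 2) := by rwa [show 2 * (k + 1) + 2 = 2 * k + 4 by ring]
  have h' : C (8 * ((k + 1 : ℕ) : ℝ) + 14) * G = C A * genL a b d e f ^ (k + 1) * genM a b d e f - normSq * lapP G := by
    rw [← h]; push_cast; ring_nf
  have h1 := lapP_remainder a b d e f hG' h'
  have hΔ2 : (lapP (lapP G)).IsHomogeneous (2 * k) := by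
    have h2 := isHomogeneous_lapP (isHomogeneous_lapP hG)
    rwa [show 2 * k + 4 - 2 - 2 = 2 * k by omega] at h2
  have h2 := congrArg lapP h1
  rw [lapP_C_mul, lapP_sub, lapP_C_mul, lapP_normSq_mul_of_isHomogeneous hΔ2] at h2
  simp only [map_mul, map_add, map_one, map_ofNat, map_natCast, Nat.cast_mul, Nat.cast_ofNat, Nat.cast_add, Nat.cast_one] at h2 ⊢
  linear_combination h2

/-- ★ The harmonic remainder of the CONFINED COMPETITOR `P_c = κ₀L^{k+3} + κ₁L^{k+2} M + ρG_c` (`ΔP_c = 0`, `G_c` homogeneous of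
degree `2k + 4`): `(8k+22) G_c = −κ₀Δ(L^{k+3}) − κ₁Δ(L^{k+2} M) − ρΔG_c`. [folklore] -/
theorem competitor_remainder {Pc Gc : RPoly} {κ₀ κ₁ : ℝ} {k : ℕ} (hGc : Gc.IsHomogeneous (2 * k + 4))
    (hPc : Pc = C κ₀ * genL a b d e f ^ (k + 3) + C κ₁ * genL a b d e f ^ (k + 2) * genM a b d e f + normSq * Gc)
    (hl : lapP Pc = 0) :
    C (8 * (k : ℝ) + 22) * Gc = -(C κ₀ * lapP (genL a b d e f ^ (k + 3)))
      - C κ₁ * lapP (genL a b d e f ^ (k + 2) * genM a b d e f) - normSq * lapP Gc := by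
  rw [hPc, lapP_add, lapP_add, lapP_C_mul, mul_assoc, lapP_C_mul, lapP_normSq_mul_of_isHomogeneous hGc] at hl
  simp only [map_mul, map_add, map_ofNat, map_natCast, Nat.cast_mul, Nat.cast_ofNat, Nat.cast_add] at hl ⊢
  linear_combination hl

/-- ★ … and one order deeper: `(16k+36) ΔG_c = −κ₀Δ²(L^{k+3}) − κ₁Δ²(L^{k+2} M) − ρΔ²G_c`. [folklore] -/
theorem competitor_lapP_remainder {Pc Gc : RPoly} {κ₀ κ₁ : ℝ} {k : ℕ} (hGc : Gc.IsHomogeneous (2 * k + 4))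
    (hPc : Pc = C κ₀ * genL a b d e f ^ (k + 3) + C κ₁ * genL a b d e f ^ (k + 2) * genM a b d e f + normSq * Gc)
    (hl : lapP Pc = 0) :
    C (16 * (k : ℝ) + 36) * lapP Gc = -(C κ₀ * lapP (lapP (genL a b d e f ^ (k + 3))))
      - C κ₁ * lapP (lapP (genL a b d e f ^ (k + 2) * genM a b d e f)) - normSq * lapP (lapP Gc) := by
  have h1 := competitor_remainder a b d e f hGc hPc hl
  have h1' : C (8 * (k : ℝ) + 22) * Gc = C (-κ₀) * lapP (genL a b d e f ^ (k + 3))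
      - C κ₁ * lapP (genL a b d e f ^ (k + 2) * genM a b d e f) - normSq * lapP Gc := by
    rw [h1, map_neg, neg_mul]
  have hΔ : (lapP Gc).IsHomogeneous (2 * k + 2) := by
    have h2 := isHomogeneous_lapP hGc
    rwa [show 2 * k + 4 - 2 = 2 * k + 2 by omega] at h2
  have h2 := congrArg lapP h1'
  rw [lapP_C_mul, lapP_sub, lapP_sub, lapP_C_mul, lapP_C_mul, lapP_normSq_mul_of_isHomogeneous hΔ] at h2
  simp only [map_mul, map_add, map_neg, map_ofNat, map_natCast, Nat.cast_mul, Nat.cast_ofNat, Nat.cast_add] at h2 ⊢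
  linear_combination h2

/-- ★ The harmonic remainder of the CONFINED `D′ − 4` SHELL `P_b = a₀L^k M² + b₀L^{k+1} M + γL^{k+2} + ρG_b` (`ΔP_b = 0`, `G_b`
homogeneous of degree `2k + 2`): `(8k+14) G_b = −a₀Δ(L^k M²) − b₀Δ(L^{k+1} M) − γΔ(L^{k+2}) − ρΔG_b`. [folklore] -/
theorem bShell_remainder {Pb Gb : RPoly} {a₀ b₀ γ : ℝ} {k : ℕ} (hGb : Gb.IsHomogeneous (2 * k + 2))
    (hPb : Pb = C a₀ * genL a b d e f ^ k * genM a b d e f ^ 2 + C b₀ * genL a b d e f ^ (k + 1) * genM a b d e f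
      + C γ * genL a b d e f ^ (k + 2) + normSq * Gb)
    (hl : lapP Pb = 0) :
    C (8 * (k : ℝ) + 14) * Gb = -(C a₀ * lapP (genL a b d e f ^ k * genM a b d e f ^ 2))
      - C b₀ * lapP (genL a b d e f ^ (k + 1) * genM a b d e f) - C γ * lapP (genL a b d e f ^ (k + 2)) - normSq * lapP Gb := by
  have hPb' : Pb = C a₀ * (genL a b d e f ^ k * genM a b d e f ^ 2) + C b₀ * (genL a b d e f ^ (k + 1) * genM a b d e f)
      + C γ * genL a b d e f ^ (k + 2) + normSq * Gb := by rw [hPb]; ring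
  rw [hPb', lapP_add, lapP_add, lapP_add, lapP_C_mul, lapP_C_mul, lapP_C_mul, lapP_normSq_mul_of_isHomogeneous hGb] at hl
  simp only [map_mul, map_add, map_ofNat, map_natCast, Nat.cast_mul, Nat.cast_ofNat, Nat.cast_add] at hl ⊢
  linear_combination hl

end Real

end Summit.NavierStokesRegularity.NavierStokesRegularity.Theorems.PoloidalLiouville.HorizonTower.Zonal

end
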